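import Mathlib
import HarnessLib
import Summits.FinalStateConjecture.Statement
import Summits.FinalStateConjecture.FinalStateConjecture.Theorems.DissipativeFinalMotionsAssemblyT2

/-!
# Route DissipativeFinalMotions — the Assembly, frame form (item stmt-FinalStateConjecture-10157) — RETIRED

The assembly item of route `DissipativeFinalMotions` ("no eternal loitering — dissipative N-body
modulation") for the Final State Conjecture is the curried statement
`FinalEraGeneric → RadiativeLyapunovBudget → DispersalFromBudget → DispersingCapture → FinalStateConjecture`,
literally the type of the route file's sorry-free deciding theorem
`Summit.FinalStateConjecture.FinalStateConjecture.Theses.DissipativeFinalMotions.closes`.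

It is pure logic. Christodoulou genericity in curve form,
`IsChristodoulouGeneric 𝓓 P 1 = HasCodimAtLeastIn 𝓓 {d ∈ 𝓓 | ¬ P d} 1`, is monotone in the property
`P` under pointwise implication on the admissible class `𝓓` (`isChristodoulouGeneric_mono` below), and
pointwise on an admissible datum and a maximal development the final-era package of `FinalEraGeneric`
(complete `𝓘⁺` plus the 31-clause era) is fed to `RadiativeLyapunovBudget` (a monotone bounded-below
budget `E` taxed by every `D`-close unit of time), the budget together with the package's Lipschitz
speed clause to `DispersalFromBudget` (pairwise dispersal `‖ξᵢ − ξⱼ‖ → ∞`), and package + dispersal to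
`DispersingCapture`, whose conclusion is verbatim the Statement's final-state clause.

Design constraint (why this file does NOT import the route module
`Summits.FinalStateConjecture.FinalStateConjecture.Theses.DissipativeFinalMotions`): when an item
closes, the gate re-renders the route file with `import <closing module>` and
`theorem Assembly_holds : Assembly := …`; a closing module that itself imports the route module makes
that render fail (import cycle — the episodes of the sibling routes `PhotonSphereChannels`,
stmt-FinalStateConjecture-10050, `EIHFluxBalance`, stmt-FinalStateConjecture-10169, and
`SwallowTheDatum`, stmt-FinalStateConjecture-10057, each of which cost a route repair). So the theorem
below is stated with the four item statements INLINED VERBATIM (the bodies of `FinalEraGeneric`,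
`RadiativeLyapunovBudget`, `DispersalFromBudget` and `DispersingCapture`, copied mechanically from the
route file rev 2 of 2026-08-15), so that its type is definitionally (by `δ`-unfolding only) the route
decl `Summit.FinalStateConjecture.FinalStateConjecture.Theses.DissipativeFinalMotions.Assembly`, and the
route file can import this module without a cycle. Imports are exactly those of the route file minus
`HarnessLib.Audit`; the `open` lines are the route file's. No analysis, no new definitions.

Record (2026-08-17, dependency-drift repair = this revision). On 2026-08-16T21:18Z the summit statement
`FinalStateConjecture` was RE-TYPED (semantic-vacuity audit, re-type T2, p126844: TAME genericity
`IsTameChristodoulouGeneric` on one fixed end; extra conclusion conjuncts `RaysStayInClosure`,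
`IsFutureOriented`); the route was repaired at rev 3 (23:25Z: `FinalEraGeneric` and `DispersingCapture`
restated, the assembly re-keyed UNCURRIED as stmt-FinalStateConjecture-17644 and closed by
`DissipativeFinalMotions.assemblyT2_frame_proof`, `Theorems/DissipativeFinalMotionsAssemblyT2.lean`), and
the route file does not import this module. Against the re-typed statement the rev-2 frame
`DissipativeFinalMotions.assembly_proof` (plain `IsChristodoulouGeneric`, no (R)/(F)/(F₀), old conclusion)
no longer elaborates (full build 2026-08-16: type mismatch at its `refine … isChristodoulouGeneric_mono …
(h₃ X)`) and is no longer a theorem of logic; none of its four hypotheses is refuted, so it cannot be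
closed vacuously either. Theorems files being append-only, the landed name is kept as a DEPRECATED ALIAS
(`@[deprecated] alias`) of the survivor `DissipativeFinalMotions.assemblyT2_frame_proof` (pattern of
`Theorems/CurvatureOrSymmetryAssemblyFrame.lean`, `Theorems/PhotonSphereChannelsAssemblyFrameR.lean`); the
rev-2 text of the four hypotheses survives in the route file's item records and in the ledger signature
of stmt-10157. The monotonicity lemma `DissipativeFinalMotions.isChristodoulouGeneric_mono` (topology-free
genericity, `Genericity.lean`) is unaffected and stays. This module closes no live item.
-/

-- every `Summit.FinalStateConjecture.FinalStateConjecture.…` name repeats the summit = sub-problem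
-- segment (D-0017 layout, CONVENTIONS §2; the lakefile sets this option for the library build, a
-- standalone elaboration of this file does not see it); the duplicate is deliberate.
set_option linter.dupNamespace false

namespace Summit.FinalStateConjecture.FinalStateConjecture.Theorems

open scoped BigOperators Topology Manifold Classical MeasureTheory ProbabilityTheory Matrix InnerProductSpace ComplexConjugate ContinuousMap
open Filter Set Function TopologicalSpace MeasureTheory

/-- Curve-genericity is **monotone in the property**: if `P d → Q d` for every admissible `d ∈ 𝓓`,
then the exceptional set of `Q` lies in that of `P`, so every admissible injective smooth family that
leaves `{d ∈ 𝓓 | ¬ P d}` off the parameter `0` also leaves `{d ∈ 𝓓 | ¬ Q d}`; hence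
`IsChristodoulouGeneric 𝓓 P m → IsChristodoulouGeneric 𝓓 Q m`. This is the whole logical content of
the assembly (the glue of the route's deciding theorem `closes`). [folklore] -/
theorem DissipativeFinalMotions.isChristodoulouGeneric_mono {E H : Type*} [NormedAddCommGroup E]
    [NormedSpace ℝ E] [TopologicalSpace H] {I : ModelWithCorners ℝ E H} {Y : Type*}
    [TopologicalSpace Y] [ChartedSpace H Y] [IsManifold I ((⊤ : ℕ∞) : WithTop ℕ∞) Y]
    {𝓓 : Set (Literature.Geometry.Lorentzian.InitialDataSet I Y)}
    {P Q : Literature.Geometry.Lorentzian.InitialDataSet I Y → Prop} (hPQ : ∀ d ∈ 𝓓, P d → Q d)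
    {m : ℕ} (h : Literature.Geometry.Lorentzian.InitialDataSet.IsChristodoulouGeneric 𝓓 P m) :
    Literature.Geometry.Lorentzian.InitialDataSet.IsChristodoulouGeneric 𝓓 Q m := by
  intro d hd
  obtain ⟨F, hF, h0, hinj, hD, hgood⟩ := h d ⟨hd.1, fun hP ↦ hd.2 (hPQ d hd.1 hP)⟩
  exact ⟨F, hF, h0, hinj, hD, fun c hc hmem ↦ hgood c hc ⟨hmem.1, fun hP ↦ hmem.2 (hPQ _ hmem.1 hP)⟩⟩

/-- Deprecated spelling: the rev-2 curried frame `FinalEraGeneric → RadiativeLyapunovBudget →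
DispersalFromBudget → DispersingCapture → FinalStateConjecture` with the REV-2 bodies inlined (item
stmt-FinalStateConjecture-10157, replaced at route rev 3 by the uncurried stmt-FinalStateConjecture-17644)
stopped elaborating when the summit statement was re-typed (T2, 2026-08-16T21:18Z: tame immersed
genericity families on one fixed end, `RaysStayInClosure`, `IsFutureOriented`) and is no longer a theorem
of logic; the repaired frame for the current assembly item is
`DissipativeFinalMotions.assemblyT2_frame_proof` (`Theorems/DissipativeFinalMotionsAssemblyT2.lean`), of
which the old name is kept as a deprecated alias (Theorems files are append-only). -/
@[deprecated DissipativeFinalMotions.assemblyT2_frame_proof (since := "2026-08-17")]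
alias DissipativeFinalMotions.assembly_proof := DissipativeFinalMotions.assemblyT2_frame_proof

end Summit.FinalStateConjecture.FinalStateConjecture.Theorems
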